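import Literature.NumberTheory.EllipticCurves.Sprung2017.HalfLogarithmMatrixInvolutionProofs
import Literature.NumberTheory.EllipticCurves.MazurTateFiniteLevelFunctionalEquationProofs
import Literature.NumberTheory.EllipticCurves.PAdicLFunctionInvolutionProofs
import Literature.NumberTheory.EllipticCurves.CuspFormLFunctionNewformFrickeProofs
import Literature.NumberTheory.EllipticCurves.PAdicLFunctionNonvanishingProofs
import Literature.NumberTheory.EllipticCurves.PAdicLFunctionNeZeroProofs
import Summits.BirchSwinnertonDyer.Rank1Residual.Supersingular.SharpFlatRankZeroReal
import HarnessLib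

/-!
# Crux `SprungLowerDivisibilityAtThree` (K1, item stmt-BirchSwinnertonDyer-19875), line `chromatic-common-zeros`:
# the ideal `(L♯, L♭) ⊂ Λ` of an X8 Sprung pair is STABLE under the involution `ι : T ↦ (1+T)⁻¹ − 1` —
# class-wide, input-free; hence so is the chromatic COMMON-ZERO LOCUS

Cell `bsd-ssimc` (host), width seat `cruxlead-stmt-BirchSwinnertonDyer-19875-w3` (gen 4) under the 19875 lead;
`--supports` 19875; theorems only; route-independent imports; closes NO item (registry: skeleton v8 unchanged).
K1, BSD and leaf X8 are NOT proved by anything here.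

## The point

At `a_p = 0` each signed `p`-adic `L`-function `L^±` has its own functional equation (Pollack; each colour's
zero set is `ι`-symmetric). At `(3, a₃ = ±3)` the `♯/♭` functional equation is colour-MIXING: only the TRACE
COORDINATES `G_j = L♯ℒ_{0j} + L♭ℒ_{1j}` (`ℒ = halfLogMatrix b`, the α-free half-logarithm matrix) satisfy
`G_j(T^ι) = σ(1+T)^c G_j(T)` (Sprung 2017 Thm. 1.1 + Thm. 4.13 / MTT §I.17 — PROVED in the tree,
`thm413_traceCoordinate_functionalEquation_three_holds`). Since `ℒ(T) = M(T)·ℒ(T^ι)` with an INTEGRAL matrix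
`M ∈ M₂(ℤ₃⟦T⟧)` (`exists_integral_halfLogMatrix_eq_mul_subst`, the integral transition matrix behind Sprung 2017
Prop. 3.14 / Cor. 4.6) and `det ℒ(0) = det C⁻² = 1/9 ≠ 0`, cancelling `ℒ` gives, in `Λ = ℤ₃⟦T⟧`,
`κ′ · L^•(T^ι) = L♯·M_{0•} + L♭·M_{1•}` with a UNIT `κ′ = (σ(1+T)^c)(T^ι)`:

* §1 `ChromaticIota.mul_map_eq_of_traceFE` — the pure algebra (any domain, any involutive ring map).
* §2 **`ClassX8.subst_invOnePlusSubOne_mem_of_mem`** — for every X8 pair `(W, 3)`, newform `f`, Sprung pair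
  `(L♯, L♭)` and EVERY ideal `J ⊂ Λ` containing `L♯` and `L♭`: `L♯(T^ι) ∈ J` and `L♭(T^ι) ∈ J`. In particular
  the set of height-one primes containing both colours (the common-zero locus of the line) is `ι`-stable
  (`ClassX8.mem_comap_subst_of_mem`). INPUT-FREE (the Fricke sign of the newform and the Teichmüller exponent of
  the level are tree theorems, as in `…BothColoursOfTraceFE`).

Consumer: the `ι`-RIGIDITY doors (next file): at equal minimal `λ` a common zero `a ≠ 0` would come with its
partner `(1+a)⁻¹ − 1 ≠ a`, forcing the two Weierstrass polynomials to coincide, i.e. `(L♯) = (L♭)`.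

References: [Sprung2017] Thm. 1.1, §3.4 Prop. 3.14, Thm. 4.13, Cor. 4.6, Cor. 4.14; [MazurTateTeitelbaum1986Invent]
§I.17; [GreenbergLNM1716] §1 (the involution); [Sprung2012] Def. 6.1, Thm. 7.14, Main Conj. 7.21 (context).
-/

set_option linter.dupNamespace false
set_option autoImplicit false

noncomputable section

open scoped Classical MatrixGroups ModularForm

open CongruenceSubgroup WeierstrassCurve
  Literature.NumberTheory.EllipticCurves Literature.NumberTheory.EllipticCurves.ModularForms
  Literature.NumberTheory.EllipticCurves.Sprung2017 Literature.NumberTheory.EllipticCurves.Rank1Residual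
  Literature.Barriers.BirchSwinnertonDyer Summit.BirchSwinnertonDyer.Rank1Residual.Supersingular

namespace Summit.BirchSwinnertonDyer.BirchSwinnertonDyer.Theorems.ChromaticIota

/-! ## §1 The algebra: cancelling the half-logarithm matrix -/

/-- **Cancelling `ℒ`.** In a domain `R` with a ring map `σ` satisfying `σ ∘ σ = id`: if the two "trace coordinates"
`G_k = L₀ℒ_{0k} + L₁ℒ_{1k}` satisfy `σ(G_k) = κ·G_k`, if `ℒ_{ik} = M_{i0}σ(ℒ_{0k}) + M_{i1}σ(ℒ_{1k})` and
`det ℒ ≠ 0`, then `σ(κ)·σ(L_l) = L₀M_{0l} + L₁M_{1l}` for `l = 0, 1`. [cite: Sprung2017, Cor. 4.6 and Prop. 3.14] -/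
theorem mul_map_eq_of_traceFE {R : Type*} [CommRing R] [IsDomain R] (σ : R →+* R) (hσσ : ∀ x, σ (σ x) = x)
    (L : Fin 2 → R) (ℒ M : Matrix (Fin 2) (Fin 2) R) (κ : R)
    (hFE : ∀ k : Fin 2, σ (L 0 * ℒ 0 k + L 1 * ℒ 1 k) = κ * (L 0 * ℒ 0 k + L 1 * ℒ 1 k))
    (hM : ∀ i k : Fin 2, ℒ i k = M i 0 * σ (ℒ 0 k) + M i 1 * σ (ℒ 1 k))
    (hdet : ℒ 0 0 * ℒ 1 1 - ℒ 0 1 * ℒ 1 0 ≠ 0) (l : Fin 2) :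
    σ κ * σ (L l) = L 0 * M 0 l + L 1 * M 1 l := by
  -- `σ(ℒ) = σ(M)·ℒ`
  have hσM : ∀ i k : Fin 2, σ (ℒ i k) = σ (M i 0) * ℒ 0 k + σ (M i 1) * ℒ 1 k := by
    intro i k
    have h := congrArg σ (hM i k)
    rw [map_add, map_mul, map_mul, hσσ, hσσ] at h
    exact h
  have h0 := hFE 0
  have h1 := hFE 1
  rw [map_add, map_mul, map_mul, hσM, hσM] at h0 h1
  -- the row vector `W = σ(L)σ(M) − κL` is killed by `ℒ`, hence vanishes
  have hW0 : (σ (L 0) * σ (M 0 0) + σ (L 1) * σ (M 1 0) - κ * L 0) * (ℒ 0 0 * ℒ 1 1 - ℒ 0 1 * ℒ 1 0) = 0 := by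
    linear_combination (ℒ 1 1) * h0 - (ℒ 1 0) * h1
  have hW1 : (σ (L 0) * σ (M 0 1) + σ (L 1) * σ (M 1 1) - κ * L 1) * (ℒ 0 0 * ℒ 1 1 - ℒ 0 1 * ℒ 1 0) = 0 := by
    linear_combination (ℒ 0 0) * h1 - (ℒ 0 1) * h0
  have hV0 : κ * L 0 = σ (L 0) * σ (M 0 0) + σ (L 1) * σ (M 1 0) := by
    have := (mul_eq_zero.mp hW0).resolve_right hdet
    linear_combination -this
  have hV1 : κ * L 1 = σ (L 0) * σ (M 0 1) + σ (L 1) * σ (M 1 1) := by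
    have := (mul_eq_zero.mp hW1).resolve_right hdet
    linear_combination -this
  fin_cases l
  · have h := congrArg σ hV0
    rw [map_mul, map_add, map_mul, map_mul, hσσ, hσσ, hσσ, hσσ] at h
    simpa using h
  · have h := congrArg σ hV1
    rw [map_mul, map_add, map_mul, map_mul, hσσ, hσσ, hσσ, hσσ] at h
    simpa using h

/-! ## §2 X8: the ideal `(L♯, L♭)` is `ι`-stable -/

/-- `ι ∘ ι = id` on `ℚ_3⟦T⟧` (private plumbing). [folklore] -/
private theorem subst_subst_rat (g : PowerSeries ℚ_[3]) :
    PowerSeries.subst (invOnePlusSubOne : PowerSeries ℚ_[3])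
      (PowerSeries.subst (invOnePlusSubOne : PowerSeries ℚ_[3]) g) = g := by
  have hι := hasSubst_invOnePlusSubOne (R := ℚ_[3])
  rw [PowerSeries.subst_comp_subst_apply hι hι, invOnePlusSubOne_subst_self, PowerSeries.X_subst]

/-- `det ℒ(0) = det C⁻² = 1/9 ≠ 0` (private plumbing). [cite: Sprung2017, §3.1 (ℒ(0) = C⁻²)] -/
private theorem det_halfLogMatrix_ne_zero (b : ℤ) :
    halfLogMatrix b 0 0 * halfLogMatrix b 1 1 - halfLogMatrix b 0 1 * halfLogMatrix b 1 0 ≠ 0 := by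
  intro h
  have h0 := congrArg PowerSeries.constantCoeff h
  rw [map_sub, map_mul, map_mul, constantCoeff_halfLogMatrix, constantCoeff_halfLogMatrix,
    constantCoeff_halfLogMatrix, constantCoeff_halfLogMatrix, map_zero] at h0
  have hdetQ : (sprungCinv 3 (3 * b) ^ 2).det = 1 / 9 := by
    rw [Matrix.det_pow, Matrix.det_fin_two]
    simp [sprungCinv]
    norm_num
  have hcast : (((sprungCinv 3 (3 * b) ^ 2).det : ℚ) : ℚ_[3]) = 0 := by
    rw [Matrix.det_fin_two]
    push_cast
    linear_combination h0
  rw [hdetQ] at hcast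
  norm_num at hcast

/-- **THE IDEAL `(L♯, L♭)` OF AN X8 SPRUNG PAIR IS `ι`-STABLE (class-wide, input-free).** For every X8 pair
`(W, 3)` (`ClassX8 W p`), its newform `f`, every Sprung pair `(L♯, L♭)` (`IsSprungPair f p a_p L♯ L♭`) and every
ideal `J` of `Λ = ℤ_p⟦T⟧` with `L♯, L♭ ∈ J`: `L♯(T^ι) ∈ J` and `L♭(T^ι) ∈ J`, `ι = (1+T)⁻¹ − 1`. Proof: the
trace-coordinate functional equation (PROVED, `thm413_traceCoordinate_functionalEquation_three_holds`, with the
newform's Fricke sign and the Teichmüller exponent of the level), `ℒ = M·ℒ(T^ι)` with `M` integral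
(`exists_integral_halfLogMatrix_eq_mul_subst`), `det ℒ ≠ 0`, and §1: `κ′·L^•(T^ι) = L♯M_{0•} + L♭M_{1•}` in `Λ`
with `κ′` a unit. [cite: Sprung2017, Thm. 1.1, Prop. 3.14, Thm. 4.13, Cor. 4.6 and Cor. 4.14]
[cite: MazurTateTeitelbaum1986Invent, §I.17] [cite: GreenbergLNM1716, §1] -/
theorem ClassX8.subst_invOnePlusSubOne_mem_of_mem :
    ∀ (W : WeierstrassCurve ℚ) [W.IsElliptic] [W.IsGloballyMinimal] (p : ℕ) [Fact p.Prime],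
      ClassX8 W p → ∀ (N : ℕ) (_ : NeZero N) (f : CuspForm (Gamma0 N) 2)
        (Lsharp Lflat : IwasawaAlgebra p),
      IsNewformOf W f → IsSprungPair f p (W.frobeniusTrace p) Lsharp Lflat →
      ∀ J : Ideal (IwasawaAlgebra p), Lsharp ∈ J → Lflat ∈ J →
        PowerSeries.subst (invOnePlusSubOne : IwasawaAlgebra p) Lsharp ∈ J ∧
          PowerSeries.subst (invOnePlusSubOne : IwasawaAlgebra p) Lflat ∈ J := by
  intro W _ _ p _ hX N hN f Lsharp Lflat hf hSP J hsJ hfJ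
  obtain ⟨hp3, ⟨hgood, -⟩, -⟩ := id hX
  subst hp3
  haveI : NeZero N := hN
  -- `a_3 = 3b`, `b = ±1`
  obtain ⟨b, hb, hab⟩ : ∃ b : ℤ, (b = 1 ∨ b = -1) ∧ W.frobeniusTrace 3 = 3 * b := by
    rcases ClassX8.frobeniusTrace_eq_three_or W 3 hX with h | h
    · exact ⟨1, Or.inl rfl, by rw [h]; norm_num⟩
    · exact ⟨-1, Or.inr rfl, by rw [h]; norm_num⟩
  rw [hab] at hSP
  -- the Fricke sign of the newform
  have hsm := IsNewform0.frickeInvolution_eq_smul_holds (N := N) (k := (2 : ℤ)) hf.1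
  have hFr : IsFrickeEigen N f (frickeEigenvalue f) := isFrickeEigen_of_frickeInvolution_eq_smul N hsm
  obtain ⟨σ, hσ, hW⟩ : ∃ σ : ℤ, σ ^ 2 = 1 ∧ IsFrickeEigen N f (-(σ : ℂ)) := by
    rcases IsNewform0.frickeEigenvalue_eq_one_or_eq_neg_one_holds (N := N) (k := (2 : ℤ)) hf.1 with h1 | h1
    · refine ⟨-1, by norm_num, ?_⟩
      have : (-((-1 : ℤ) : ℂ)) = frickeEigenvalue f := by rw [h1]; push_cast; ring
      rw [this]; exact hFr
    · refine ⟨1, by norm_num, ?_⟩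
      have : (-((1 : ℤ) : ℂ)) = frickeEigenvalue f := by rw [h1]; push_cast; ring
      rw [this]; exact hFr
  -- the Teichmüller exponent of the level (`3 ∤ N`)
  have hpN : ¬ 3 ∣ N := not_dvd_level_of_isNewformOf hf hgood
  obtain ⟨ηN, c, hc⟩ := exists_teichmuller_exponent_natCast (p := 3) hpN
  -- the functional equation of the trace coordinates (PROVED fact) and the integral transition matrix
  have hFE := thm413_traceCoordinate_functionalEquation_three_holds W N f b hb hf hgood hab σ hσ hW ηN c hc
    invOnePlusSubOne one_add_X_mul_invOnePlusSubOne_add_one Lsharp Lflat hSP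
  obtain ⟨M, hM⟩ := exists_integral_halfLogMatrix_eq_mul_subst b
  -- §1 in `ℚ_3⟦T⟧`
  have hι := hasSubst_invOnePlusSubOne (R := ℚ_[3])
  set τ : PowerSeries ℚ_[3] →+* PowerSeries ℚ_[3] := (PowerSeries.substAlgHom hι).toRingHom with hτ
  have hτapp : ∀ x : PowerSeries ℚ_[3], τ x = PowerSeries.subst (invOnePlusSubOne : PowerSeries ℚ_[3]) x :=
    fun x => by rw [hτ, AlgHom.toRingHom_eq_coe, RingHom.coe_coe, PowerSeries.coe_substAlgHom]
  have hττ : ∀ x, τ (τ x) = x := fun x => by rw [hτapp, hτapp, subst_subst_rat]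
  set κ : PowerSeries ℚ_[3] :=
    (σ : PowerSeries ℚ_[3]) * (PowerSeries.binomialSeries ℤ_[3] c).map (algebraMap ℤ_[3] ℚ_[3]) with hκ
  set L : Fin 2 → PowerSeries ℚ_[3] := ![iwasawaToPowerSeries 3 Lsharp, iwasawaToPowerSeries 3 Lflat] with hL
  have hL0 : L 0 = iwasawaToPowerSeries 3 Lsharp := rfl
  have hL1 : L 1 = iwasawaToPowerSeries 3 Lflat := rfl
  have hFE' : ∀ k : Fin 2, τ (L 0 * halfLogMatrix b 0 k + L 1 * halfLogMatrix b 1 k) =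
      κ * (L 0 * halfLogMatrix b 0 k + L 1 * halfLogMatrix b 1 k) := by
    intro k
    rw [hτapp, hL0, hL1]
    exact hFE k
  have hM' : ∀ i k : Fin 2, halfLogMatrix b i k =
      (M.map (iwasawaToPowerSeries 3)) i 0 * τ (halfLogMatrix b 0 k) +
        (M.map (iwasawaToPowerSeries 3)) i 1 * τ (halfLogMatrix b 1 k) := by
    intro i k
    rw [Matrix.map_apply, Matrix.map_apply, hτapp, hτapp]
    exact hM i k
  have key := mul_map_eq_of_traceFE τ hττ L (halfLogMatrix b) (M.map (iwasawaToPowerSeries 3)) κ hFE' hM'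
    (det_halfLogMatrix_ne_zero b)
  -- pull back to `Λ`: `κ′·L^•(T^ι) = L♯M_{0•} + L♭M_{1•}` with `κ′ = (σ(1+T)^c)(T^ι)` a unit of `Λ`
  set κΛ : IwasawaAlgebra 3 := (σ : IwasawaAlgebra 3) * PowerSeries.binomialSeries ℤ_[3] c with hκΛ
  have hκι : κ = iwasawaToPowerSeries 3 κΛ := by
    rw [hκ, hκΛ, map_mul, map_intCast]
  have hunit : IsUnit (PowerSeries.subst (invOnePlusSubOne : IwasawaAlgebra 3) κΛ) := by
    have hu : IsUnit κΛ := by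
      rw [hκΛ]
      refine IsUnit.mul ?_ ?_
      · have : (σ : IwasawaAlgebra 3) * (σ : IwasawaAlgebra 3) = 1 := by
          rw [← pow_two, ← Int.cast_pow, hσ, Int.cast_one]
        exact isUnit_iff_exists_inv.mpr ⟨_, this⟩
      · rw [PowerSeries.isUnit_iff_constantCoeff, PowerSeries.binomialSeries_constantCoeff]
        exact isUnit_one
    have hιΛ := hasSubst_invOnePlusSubOne (R := ℤ_[3])
    rw [← PowerSeries.coe_substAlgHom hιΛ]
    exact hu.map _
  have hpull : ∀ (Ll : IwasawaAlgebra 3) (m0 m1 : IwasawaAlgebra 3),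
      τ κ * τ (iwasawaToPowerSeries 3 Ll) = iwasawaToPowerSeries 3 Lsharp * iwasawaToPowerSeries 3 m0 +
        iwasawaToPowerSeries 3 Lflat * iwasawaToPowerSeries 3 m1 →
      PowerSeries.subst (invOnePlusSubOne : IwasawaAlgebra 3) κΛ *
          PowerSeries.subst (invOnePlusSubOne : IwasawaAlgebra 3) Ll = Lsharp * m0 + Lflat * m1 := by
    intro Ll m0 m1 h
    apply iwasawaToPowerSeries_injective 3
    rw [map_mul, map_add, map_mul, map_mul, iwasawaToPowerSeries_subst_invOnePlusSubOne,
      iwasawaToPowerSeries_subst_invOnePlusSubOne, ← hκι, ← hτapp, ← hτapp]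
    exact h
  have hmem : ∀ (Ll m0 m1 : IwasawaAlgebra 3),
      PowerSeries.subst (invOnePlusSubOne : IwasawaAlgebra 3) κΛ *
          PowerSeries.subst (invOnePlusSubOne : IwasawaAlgebra 3) Ll = Lsharp * m0 + Lflat * m1 →
      PowerSeries.subst (invOnePlusSubOne : IwasawaAlgebra 3) Ll ∈ J := by
    intro Ll m0 m1 h
    have hJ : Lsharp * m0 + Lflat * m1 ∈ J := J.add_mem (J.mul_mem_right _ hsJ) (J.mul_mem_right _ hfJ)
    rw [← h] at hJ
    exact (Ideal.unit_mul_mem_iff_mem J hunit).mp hJ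
  refine ⟨hmem Lsharp (M 0 0) (M 1 0) (hpull _ _ _ ?_), hmem Lflat (M 0 1) (M 1 1) (hpull _ _ _ ?_)⟩
  · have h := key 0
    rw [hL0, hL1, Matrix.map_apply, Matrix.map_apply] at h
    simpa using h
  · have h := key 1
    rw [hL0, hL1, Matrix.map_apply, Matrix.map_apply] at h
    simpa using h

/-- **The common-zero locus is `ι`-stable.** For an X8 Sprung pair and any ideal `J` (e.g. a height-one prime)
containing both colours, the PREIMAGE ideal `ι⁻¹J = {h : h(T^ι) ∈ J}` also contains both colours.
[cite: Sprung2017, Thm. 4.13 and Cor. 4.14] [cite: GreenbergLNM1716, §1] -/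
theorem ClassX8.mem_comap_subst_of_mem (W : WeierstrassCurve ℚ) [W.IsElliptic] [W.IsGloballyMinimal] (p : ℕ)
    [Fact p.Prime] (hX : ClassX8 W p) {N : ℕ} [hN : NeZero N] (f : CuspForm (Gamma0 N) 2)
    (Lsharp Lflat : IwasawaAlgebra p) (hf : IsNewformOf W f)
    (hSP : IsSprungPair f p (W.frobeniusTrace p) Lsharp Lflat) (J : Ideal (IwasawaAlgebra p))
    (hs : Lsharp ∈ J) (hfl : Lflat ∈ J) :
    Lsharp ∈ J.comap (PowerSeries.substAlgHom (hasSubst_invOnePlusSubOne (R := ℤ_[p]))).toRingHom ∧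
      Lflat ∈ J.comap (PowerSeries.substAlgHom (hasSubst_invOnePlusSubOne (R := ℤ_[p]))).toRingHom := by
  obtain ⟨h1, h2⟩ := ClassX8.subst_invOnePlusSubOne_mem_of_mem W p hX N hN f Lsharp Lflat hf hSP J hs hfl
  rw [Ideal.mem_comap, Ideal.mem_comap, AlgHom.toRingHom_eq_coe, RingHom.coe_coe, PowerSeries.coe_substAlgHom]
  exact ⟨h1, h2⟩

end Summit.BirchSwinnertonDyer.BirchSwinnertonDyer.Theorems.ChromaticIota

end
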